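import Summits.HodgeConjecture.HodgeConjecture.Theses.HeckeOrbitCompactness
import Summits.HodgeConjecture.HodgeConjecture.Theorems.HeckeOrbitCompactnessAssembly
import Summits.HodgeConjecture.HodgeConjecture.Theorems.PadicSemiregularLiftHodgeAbelianVarietiesStubWeilSectorOffReach
import Literature.AlgebraicGeometry.HodgeTheory.WeilClassesSixfolds

/-!
# Line `HypOrbitGlue` — LADDER skeleton for crux `HeckeOrbitCompactness.OrbitGlue` (stmt-HodgeConjecture-12682)

Route `route-HodgeConjecture-HeckeOrbitCompactness`; forward generator G4 `ladder-down` from the LADDER TOP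
`HeckeOrbitCompactness.Assembly` (stmt-HodgeConjecture-14501, landed conditional equivalence
`Theorems.heckeOrbitCompactness_assembly_iff_hodgeConjecture`); planner fwd-ladder-HodgeConjecture-14501,
2026-08-17. Companion files in this directory: `Lines/HypOrbitGlue.md` (line card), `Lines/HypOrbitGlue_special.lean`
(the compiled floor witness), `LADDER-Assembly.md` (the graded ladder of the top).

## What the top is, mod the landed frame theorems

`Assembly := OrbitDegreeBound → HodgeConjecture` splits (`heckeOrbitCompactness_assembly_iff_orbitGlue_and`) as
`OrbitGlue ∧ (OrbitDegreeBound → SummitOffWeilSector)`; the second conjunct is the summit granted the Weil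
sector, so the top's own content is THIS crux, `OrbitGlue : OrbitDegreeBound → WeilClassesAlgebraic`
("compactness: bounded degree at the dense set of orbit points ⇒ Weil classes algebraic everywhere").
Its target `WeilClassesAlgebraic` IS `∀ n ≥ 2, ∀ d ≥ 1, WeilAlgebraicAll n d`
(`Stubs.WeilSectorOffReach.weilClassesAlgebraic_iff_weilAlgebraicAll`; the two routes' copies of the target
are syntactically equal, `Theorems.tropicalCuspLift_weilClassesAlgebraic_iff_heckeOrbitCompactness : _ := Iff.rfl`),
and DESCENDING is a THEOREM of the tree (`PrymCanonicalZ3SplitSeeds.Stubs.Descend.stub_descend`: split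
`2(n+1)`-folds give every Weil-type `2n`-fold, all `n ≥ 2`, `d ≥ 1` — Schoen 1998 §10, Markman
arXiv:2509.23403 §11.5 Step 2), so the sector reduces to its SPLIT cells `Stubs.WeilAlgebraicSplitHyperplane n d`,
`n ≥ 3` (`Stubs.WeilSectorOffReach.weilClassesAlgebraic_of_markman_of_eTower`).

## The ladder (gradation parameter = half-dimension `n`)

`HypOrbitGlue n := OrbitDegreeBoundAt n → ∀ d ≥ 1, Stubs.WeilAlgebraicSplitHyperplane n d`.

* FLOOR `n = 3`: conclusion = Markman 2025 Thm 1.5.1 (`Markman2025_weilClasses_algebraic_hyperbolicSixfold`,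
  named fact, unproved in the tree; dictionary `hypWeilClassesAlgebraic_three_iff_markman`); the witness
  `example (hM : …Sixfold) : HypOrbitGlue 3` is `Lines/HypOrbitGlue_special.lean`. (`n = 2`: Markman
  arXiv:2509.23403 Thm 1.2, fact `Markman2025_weilClasses_algebraic_abelianFourfold`, all discriminants.)
* NEXT RUNG `n = 4` = `stub_rung4` (hypothesis = the route's rank-3 crux `EightfoldOrbitBound`, `Iff.rfl`):
  located stop of the floor's proof — Markman's secant-sheaf / semiregularity engine proves the CONCLUSION
  outright at `n ≤ 3` and is non-surjective (the secant variety of pure spinors is a proper subvariety of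
  `ℙ(S⁺)`) and "unlikely to be semiregular" at `n ≥ 4` (arXiv:2502.03415 §1.2, Rem. 8.2.3); the rung instead
  USES the hypothesis: bounded `P`-complexity of the Weil plane at every point of the `K`-isogeny orbit of the
  split squares (Zariski-dense in the split component of the Weil-type moduli, Landherr + `weilFamilyReach`)
  ⇒ the bounded-degree algebraicity locus, a FINITE union of closed Noether–Lefschetz components
  (`voisin2007_algebraicityLocus_iUnion_qbarClosed`, CDK95), contains a dense set ⇒ is everything.
* GAP `n ≥ 5` = `stub_higher` (the further rungs; the compactness/density argument is uniform in `n`, the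
  floor's engine is not).
* `OrbitGlue_of`: floor (named-fact hypothesis) → rung 4 → higher rungs → `OrbitGlue` BY NAME (proved below,
  no sorry): slice `X` (`orbitDegreeBound_iff_forall_at`), feed the E-tower, descend (theorem), `Iff.rfl`.
  With the route's other binder `SummitOffWeilSector` this is the top: `Assembly_of`.

Probes (folder `bc/`, quoted in the line card): `HypOrbitGlue 4 → HodgeConjecture`, `→ Assembly`, `→ OrbitGlue`
FAIL; floor → rung (`…Sixfold → HypOrbitGlue 4`, `HypOrbitGlue 3 → HypOrbitGlue 4`) FAIL; each stub → crux /
→ summit FAIL; on-path `HodgeConjecture → HypOrbitGlue n` PROVED (`hypOrbitGlue_of_hodgeConjecture`).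
-/

-- `Summit.<Summit>.<Problem>` is the tree's mandated summit-side namespace (CONVENTIONS §2); deliberate duplicate.
set_option linter.dupNamespace false

namespace Summit.HodgeConjecture.HodgeConjecture.Cruxes.OrbitGlue.HypOrbitGlue

open CategoryTheory
open Literature.AlgebraicGeometry Literature.AlgebraicGeometry.Motives
open Literature.AlgebraicGeometry.HodgeTheory
open Summit.HodgeConjecture.HodgeConjecture.Theses.HeckeOrbitCompactness
open Summit.HodgeConjecture.HodgeConjecture.Cruxes.HodgeAbelianVarieties.EStepSecantInduction
open Summit.HodgeConjecture.HodgeConjecture.Cruxes.HodgeAbelianVarieties.PrymCanonicalZ3SplitSeeds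

/-- `X` at ONE half-dimension `n`: the body of the route's rank-2 crux `OrbitDegreeBound` with `n` fixed
(the ladder's gradation parameter). `OrbitDegreeBoundAt 4` is the route's rank-3 crux `EightfoldOrbitBound`
on the nose (`Iff.rfl`, below), and `OrbitDegreeBound ↔ ∀ n ≥ 1, OrbitDegreeBoundAt n`. -/
def OrbitDegreeBoundAt (n : ℕ) : Prop :=
  ∀ (d t t' : ℕ), 0 < d → ∃ M : ℕ, ∀ (B₀ : Literature.AlgebraicGeometry.Motives.AbelianVariety ℂ) (PB : Literature.AlgebraicGeometry.Motives.CartierDivisor B₀.X.left) [AlgebraicGeometry.IsDominant (Literature.AlgebraicGeometry.Motives.AbelianVariety.Hom.toSchemeHom (Literature.AlgebraicGeometry.Motives.AbelianVariety.fst B₀ B₀))] [AlgebraicGeometry.IsDominant (Literature.AlgebraicGeometry.Motives.AbelianVariety.Hom.toSchemeHom (Literature.AlgebraicGeometry.Motives.AbelianVariety.snd B₀ B₀))], B₀.dim = n → PB.IsAmple → PB.IsSection 1 → PB.h0 ℂ = t → ∀ (A : Literature.AlgebraicGeometry.Motives.AbelianVariety ℂ) (g : B₀.prod B₀ ⟶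 A) (φ : A ⟶ A) (P : Literature.AlgebraicGeometry.Motives.CartierDivisor A.X.left) (N : ℕ) [AlgebraicGeometry.IsDominant (Literature.AlgebraicGeometry.Motives.AbelianVariety.Hom.toSchemeHom g)], Literature.AlgebraicGeometry.Motives.AbelianVariety.IsIsogeny g → A.dim = 2 * n → Literature.AlgebraicGeometry.Motives.IsSmoothProjective (2 * n) A.X → 1 ≤ N → CategoryTheory.CategoryStruct.comp (Literature.AlgebraicGeometry.Motives.AbelianVariety.prodLift (-(d • Literature.AlgebraicGeometry.Motives.AbelianVariety.snd B₀ B₀)) (Literature.AlgebraicGeometry.Motives.AbelianVariety.fst B₀ B₀)) g = CategoryTheory.CategoryStruct.comp g φ → CategoryTheory.CategoryStruct.comp φ φ = -(d • CategoryTheory.CategoryStruct.id A) → P.IsAmple → P.IsSection 1 → P.h0 ℂ = t' → (P.pullback (Literature.AlgebraicGeometry.Motives.AbelianVariety.Hom.toSchemeHom g)).LinEquiv (N • (PB.pullback (Literature.AlgebraicGeometry.Motives.AbelianVariety.Hom.toSchemeHom (Literature.AlgebraicGeometry.Motives.AbelianVariety.fst B₀ B₀)) + d • PB.pullback (Literature.AlgebraicGeometry.Motives.AbelianVariety.Hom.toSchemeHom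 (Literature.AlgebraicGeometry.Motives.AbelianVariety.snd B₀ B₀)))) → ∀ c : Literature.AlgebraicGeometry.HodgeTheory.complexBetti A.X (2 * n), Literature.AlgebraicGeometry.HodgeTheory.IsRationalClass c → c ∈ Literature.AlgebraicGeometry.HodgeTheory.weilClassesOf A φ n d → c ∈ ⨆ (D : Fin n → Literature.AlgebraicGeometry.Motives.CartierDivisor A.X.left) (_ : ∀ i, (D i).IsSection 1 ∧ ∃ k : ℕ, k ≤ M ∧ (D i).LinEquiv (k • P)) (_ : ∀ z ∈ {z | ∀ i, ¬ (D i).Avoids z}, ((n : ℕ) : ℕ∞) ≤ Order.coheight z), LinearMap.ker (Literature.AlgebraicGeometry.HodgeTheory.complexBetti.restrictCompl A.X {z | ∀ i, ¬ (D i).Avoids z} (2 * n)).hom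

/-- The SPLIT (= hyperbolic) cell of the imaginary-quadratic Weil sector at half-dimension `n`, every
`K = ℚ(√-d)`: on every complex abelian `2n`-fold `(A, φ)`, `φ ≫ φ = -d`, carrying a `K`-symmetrised
hyperplane class `d·h + φ^*h` of hyperbolic type (`IsHyperbolicWeilType`: a `φ^*`-stable rational Lagrangian
frame — Witt index `n`, discriminant `(-1)ⁿ`; Landherr / van Geemen 5.4 / Markman survey §11.5 Step 1),
every rational `(n,n)`-class of the Weil plane `weilClassesOf A φ n d = E₊ ⊔ E₋` is algebraic. This is the
tree's typed E-tower cell `Stubs.WeilAlgebraicSplitHyperplane n d` (crux HodgeAbelianVarieties, module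
`Theorems/PadicSemiregularLiftHodgeAbelianVarietiesStubSplitSixfolds`), quantified over `d`; at `n = 3` it IS
Markman's Theorem 1.5.1 = the named fact `Markman2025_weilClasses_algebraic_hyperbolicSixfold`
(`Stubs.weilAlgebraicSplitHyperplane_three_iff_markman`). -/
def HypWeilClassesAlgebraic (n : ℕ) : Prop :=
  ∀ d : ℕ, 0 < d → Stubs.WeilAlgebraicSplitHyperplane n d

/-- **RUNG `θ = n`** of the ladder below the top `HeckeOrbitCompactness.Assembly`: the uniform orbit
degree bound at half-dimension `n` (X restricted to `dim B₀ = n`) implies that the Weil classes of every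
SPLIT-type Weil `2n`-fold are algebraic, for every `K = ℚ(√-d)`. Floor `n = 3` (conclusion known outright:
Markman 2025, arXiv:2502.03415 Thm 1.5.1); NEXT RUNG `n = 4` (Weil's 1977 range: no Weil class on a
general Weil-type eightfold is known algebraic for any imaginary quadratic `K`). -/
def HypOrbitGlue (n : ℕ) : Prop :=
  OrbitDegreeBoundAt n → HypWeilClassesAlgebraic n

/-- `X` is the conjunction of its half-dimension slices. -/
theorem orbitDegreeBound_iff_forall_at : OrbitDegreeBound ↔ ∀ n : ℕ, 1 ≤ n → OrbitDegreeBoundAt n :=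
  ⟨fun h n hn d t t' hd => h n d t t' hn hd, fun h n d t t' hn hd => h n hn d t t' hd⟩

/-- The route's rank-3 crux `EightfoldOrbitBound` (stmt-HodgeConjecture-13690) IS the slice `n = 4`. -/
theorem eightfoldOrbitBound_iff_at_four : EightfoldOrbitBound ↔ OrbitDegreeBoundAt 4 := Iff.rfl

/-- FLOOR dictionary: the rung's conclusion at `n = 3` is Markman's Theorem 1.5.1 (named fact of the tree). -/
theorem hypWeilClassesAlgebraic_three_iff_markman :
    HypWeilClassesAlgebraic 3 ↔ Markman2025_weilClasses_algebraic_hyperbolicSixfold :=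
  Stubs.weilAlgebraicSplitHyperplane_three_iff_markman

/-- ON-PATH (F4): every rung is a consequence of the summit (the Hodge conjecture for `A.X` in dimension `2n`
gives the Weil classes whatever the hypothesis). [cite: Deligne2000, §1] -/
theorem hypOrbitGlue_of_hodgeConjecture (h : _root_.HodgeConjecture) (n : ℕ) : HypOrbitGlue n :=
  fun _ _ _ _ _ _ _ hA _ _ _ _ =>
    Stubs.weilAlgebraicFor_of_hodgeConjectureFor (h (isSmoothProjective_of_dim_eq' hA))

/-! ### Registered stubs -/

/-- STUB `stub_rung4` (research, XL) — THE NEXT RUNG `θ₁ = 4`. Hypothesis: `OrbitDegreeBoundAt 4` =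
`EightfoldOrbitBound` (one integer `M(d,t,t')` bounding the `P`-complexity of the rational Weil plane at every
abelian eightfold of the `ℚ(√-d)`-isogeny orbit of the split squares `B₀ × B₀`, `dim B₀ = 4`). Conclusion:
the Weil classes of EVERY split-type Weil eightfold are algebraic, every `K = ℚ(√-d)` — open in print for
every `K` (Weil 1977; Markman's secant engine stops at `n = 3`, arXiv:2502.03415 §1.2). Intended proof
(compactness + density, uniform in `n`): (i) TRANSPORT — an isogeny `g` carries bounded classes to bounded
classes and Weil planes to Weil planes (`mem_algebraicClasses_of_isogeny_of_mem_weilClassesOf`,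
OrbitKTransport-type bookkeeping), so the hypothesis holds on the whole `K`-isogeny (Hecke) orbit;
(ii) DENSITY — that orbit is Zariski-dense in the split component `S` of the moduli of polarized Weil-type
eightfolds with `K`-action (Landherr: one hermitian genus of discriminant `+1`; `weilFamilyReach_hyperbolic`);
(iii) COMPACTNESS — `D_M = { s ∈ S : W_ℚ(s) ⊆ span of classes of effective cycles of P-degree ≤ f(M) }` is
Zariski-CLOSED (proper relative Chow scheme of the universal family; = a FINITE union of the closed
Noether–Lefschetz components of CDK95 / `voisin2007_algebraicityLocus_iUnion_qbarClosed`), so `D_M = S`;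
(iv) every split-type `(A, φ, d·h + φ^*h)` lies on `S` (reach). Why it might fail: (ii)–(iv) are not yet
carried by the tree (no relative Chow / relative Cartier divisors over `IsSmoothProjectiveFamily`), and the
uniformity in the polarization TYPE `t'` must be matched to the hyperplane class of the conclusion. -/
theorem stub_rung4 : HypOrbitGlue 4 := by
  sorry

/-- STUB `stub_higher` (research, XL) — THE FURTHER RUNGS `n ≥ 5` (gap items of the ladder, one statement):
same implication at every half-dimension `n ≥ 5`. By the intended compactness + density argument this is
NOT harder than `stub_rung4` (steps (i)–(iv) are uniform in `n`: Landherr's classification, the relative Chow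
scheme and isogeny transport do not see `n`); by the floor's engine it is out of reach (secant sheaves are
non-surjective for all `n ≥ 4`). Kept separate so that the rung `n = 4` — whose hypothesis is the route's own
rank-3 crux `EightfoldOrbitBound` — can close first. -/
theorem stub_higher : ∀ n : ℕ, 5 ≤ n → HypOrbitGlue n := by
  sorry

/-! ### Composition: the crux BY NAME -/

/-- **`OrbitGlue` from the ladder.** FLOOR (Markman 2025 Thm 1.5.1 as the tree's named fact) + RUNG `n = 4`
+ the higher rungs give `HeckeOrbitCompactness.OrbitGlue`: slice `X` by half-dimension, obtain every split
cell `n ≥ 4` of the E-tower, and descend (THEOREM `Stubs.Descend.stub_descend`) to the whole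
imaginary-quadratic Weil sector (`weilClassesAlgebraic_of_markman_of_eTower`); the two routes' copies of
`WeilClassesAlgebraic` agree by `Iff.rfl`. [cite: Markman2025SecantWeil, Thm. 1.5.1]
[cite: Markman2025SurveySecant, §11.5 Step 2] [cite: Schoen1998HodgeWeilAddendum, §10] -/
theorem OrbitGlue_of : Markman2025_weilClasses_algebraic_hyperbolicSixfold → HypOrbitGlue 4 →
    (∀ n : ℕ, 5 ≤ n → HypOrbitGlue n) →
      Summit.HodgeConjecture.HodgeConjecture.Theses.HeckeOrbitCompactness.OrbitGlue := by
  intro hM h4 hup hX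
  have hXn := orbitDegreeBound_iff_forall_at.1 hX
  have hE : ∀ n d : ℕ, 4 ≤ n → 0 < d → Stubs.WeilAlgebraicSplitHyperplane n d := by
    intro n d hn hd
    rcases Nat.lt_or_ge n 5 with h | h
    · obtain rfl : n = 4 := by omega
      exact h4 (hXn 4 (by norm_num)) d hd
    · exact hup n h (hXn n (by omega)) d hd
  exact (Stubs.WeilSectorOffReach.weilClassesAlgebraic_of_markman_of_eTower hM hE :)

/-- … and with the route's other `closes` binder `SummitOffWeilSector` (stmt-HodgeConjecture-14189), the
LADDER TOP `Assembly` (stmt-HodgeConjecture-14501) by name (`heckeOrbitCompactness_assembly_of_cruxes`). -/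
theorem Assembly_of (hM : Markman2025_weilClasses_algebraic_hyperbolicSixfold) (h4 : HypOrbitGlue 4)
    (hup : ∀ n : ℕ, 5 ≤ n → HypOrbitGlue n)
    (hS : Summit.HodgeConjecture.HodgeConjecture.Theses.HeckeOrbitCompactness.SummitOffWeilSector) :
    Summit.HodgeConjecture.HodgeConjecture.Theses.HeckeOrbitCompactness.Assembly :=
  Summit.HodgeConjecture.HodgeConjecture.Theorems.heckeOrbitCompactness_assembly_of_cruxes
    (OrbitGlue_of hM h4 hup) hS

/-- The line from its registered stubs, granted the floor fact (shape used by the lead machinery). -/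
theorem OrbitGlue_of_stubs (hM : Markman2025_weilClasses_algebraic_hyperbolicSixfold) :
    Summit.HodgeConjecture.HodgeConjecture.Theses.HeckeOrbitCompactness.OrbitGlue :=
  OrbitGlue_of hM stub_rung4 stub_higher

end Summit.HodgeConjecture.HodgeConjecture.Cruxes.OrbitGlue.HypOrbitGlue
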